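import Literature.Analysis.ValidatedNumerics.TaylorModelBivariate
import Literature.Analysis.ValidatedNumerics.TaylorModelQuadrature
import Mathlib.MeasureTheory.Integral.Prod
import HarnessLib

/-!
# Kernel-checkable certificates for double integrals over rectangles (Taylor-model quadrature in two variables)

Trunk T-ANA (Analysis/ValidatedNumerics); namespace `Literature.Analysis.ValidatedNumerics.PolyMP`.
Sequel of `TaylorModelBivariate.lean` (bivariate Taylor models `TMem2 S h k f P`, their arithmetic, range bound
`tabs2` and the exponential) and `TaylorModelQuadrature.lean` (exact integration of rational polynomials).  The
quadrature ALGORITHM 2 of Makino–Berz ("Quadrature with Taylor Models": model the integrand over the box in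
Taylor-model arithmetic starting from the identity models, integrate the polynomial part exactly by manipulating
coefficients, and enclose `∫_D f ⊂ ∫_D P + |D|·I`) for the ITERATED integral `∫_{x} ∫_{y} f(x, y) dy dx` over a
rectangle, packaged — as in the univariate `TaylorModelIntegralCert.lean` — as ONE Boolean certificate evaluated by
the kernel and ONE soundness theorem without side hypotheses:

* exact part: `integRowQ r k = ∫_{-k}^{k} r`, `integ2Q p h k = ∫_{-h}^{h} ∫_{-k}^{k} Σᵢ ρⁱ pᵢ(σ) dσ dρ` for rational
  rows `p : List Poly` (`integral_evalR2_ratRows`, `integral2_evalR2_ratRows`);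
* the BOX ESTIMATE `abs_integral2_sub_integ2Q_le`: if `P` encloses a jointly measurable `f` on `|ρ| ≤ h, |σ| ≤ k`,
  then `|∫_{-h}^{h} ∫_{-k}^{k} f − integ2Q p h k| ≤ (tabs2 S h k (P − p)/S) · (2k) · (2h)` for every rational `p`
  (step 4 of op. cit. Algorithm 2 with `I ⊇ P − p` bounded on the box), together with the integrability of the
  sections `σ ↦ f ρ σ` and of the inner integral `ρ ↦ ∫ f ρ σ dσ` (boundedness from the model, measurability of the
  inner integral by `StronglyMeasurable.integral_prod_right`) — so no integrability hypothesis survives;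
* the expression language `BExpr` in the two variables (`const q`, `varX`, `varY`, `neg`, `add`, `mul`, `exp`),
  its meaning `BExpr.toFun₂`, joint measurability, the box model `BExpr.model S h k D K Ke ke cx cy E` of
  `(u, v) ↦ E(cx + u, cy + v)` (steps 1–2 of Algorithm 2) with `BExpr.tmem2_model`;
* the certificate: `boxEncl` (one box: `ofRat (integ2Q p) ± ⌈B·4hk⌉`, `p` the midpoint rows), `stripEncl` (a column
  of `m` boxes: additivity of the inner integral in `y`, then of the outer integrand), `gridEncl` (`n` columns:
  additivity in `x`), `certCheck2 S h k D K Ke ke E ax ay n m lo hi` and **`integral_bounds_of_certCheck2`**: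
  `certCheck2 … = true → lo ≤ ∫_{ax}^{ax+2nh} ∫_{ay}^{ay+2mk} E(x, y) dy dx ≤ hi`.  Positivity of `S`, `h`, `k` and
  every acceptance condition are part of the certificate.

Deliberately NOT here: reciprocal, square root and logarithm nodes (the univariate verification rules
`checkInv` / `checkSqrt` / `tlogTM` have no bivariate port yet), non-rectangular domains, adaptive subdivision (the
generator chooses `n`, `m`, `h`, `k`, the total degree `D`, the orders and the scale `S`), dimension `≥ 3`.
Cost: the kernel time of one box is dominated by the `K` bivariate Horner steps of an `exp` node acting on the
`(D+1)(D+2)/2`-entry coefficient triangle; separable structure is best exposed in the expression itself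
(`exp(-x²) · exp(-y²)` keeps both exponentials univariate and costs one truncated outer product, whereas
`exp(-(x²+y²))` runs the dense bivariate Horner).  Problem-independent; no facts, no axioms.

## References

* K. Makino, M. Berz, *Taylor models and other validated functional inclusion methods*, Int. J. Pure Appl.
  Math. 4 (2003) 379–456, Algorithm 2 (Quadrature with Taylor Models), Definitions 1–3.
  [cite: MakinoBerz2003, Algorithm 2]
* M. Berz, K. Makino, *New methods for high-dimensional verified quadrature*, Reliable Computing 5 (1999) 13–22.
  [cite: BerzMakino1999, Sect. 2]
* A. Mahboubi, G. Melquiond, T. Sibut-Pinote, *Formally verified approximations of definite integrals*, ITP 2016,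
  LNCS 9807, 274–289, Sect. 3.2 Lemma 3 and Sect. 3.3 (polynomial integral enclosure, decomposition of the domain,
  enclosures checked by computation — the certificate shape). [cite: MahboubiMelquiondSibutpinote2016, Sect. 3.2 Lemma 3]
-/

open MeasureTheory intervalIntegral Set
open scoped Interval

namespace Literature.Analysis.ValidatedNumerics

namespace PolyMP

open Literature.Analysis.ValidatedNumerics.NumericsMP
open Literature.Analysis.ValidatedNumerics.ExpPoly (Poly)
open Literature.Analysis.ValidatedNumerics.ExpPoly

/-! ### Exact double integrals of rational coefficient rows -/

/-- `∫_{-k}^{k} r(σ) dσ` as an exact rational (antiderivative `Poly.ad 0`). [cite: MakinoBerz2003, Algorithm 2] -/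
def integRowQ (r : Poly) (k : ℚ) : ℚ := Poly.evalQ (Poly.ad 0 r) k - Poly.evalQ (Poly.ad 0 r) (-k)

/-- [cite: MakinoBerz2003, Algorithm 2] -/
theorem integral_eval_eq_integRowQ (r : Poly) (k : ℚ) :
    ∫ σ in (-(k : ℝ))..k, Poly.eval r σ = ((integRowQ r k : ℚ) : ℝ) := by
  rw [integral_eq_sub_of_hasDerivAt (fun x _ => hasDerivAt_eval_ad_zero r x)
    ((Poly.continuous_eval _).intervalIntegrable _ _), integRowQ, Rat.cast_sub, Poly.eval_evalQ, Poly.eval_evalQ]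
  push_cast
  ring

/-- `∫_{-h}^{h} ∫_{-k}^{k} Σᵢ ρⁱ pᵢ(σ) dσ dρ` as an exact rational: integrate every row, then the resulting polynomial
in `ρ` (step 3 of op. cit. Algorithm 2). [cite: MakinoBerz2003, Algorithm 2] -/
def integ2Q (p : List Poly) (h k : ℚ) : ℚ := integRowQ (p.map fun r => integRowQ r k) h

/-- The real rows of a list of rational rows. [cite: MakinoBerz2003, Algorithm 2] -/
noncomputable def ratRows (p : List Poly) : List (List ℝ) := p.map fun r => r.map ((↑) : ℚ → ℝ)

/-- [cite: MakinoBerz2003, Algorithm 2] -/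
@[simp] theorem ratRows_nil : ratRows [] = [] := rfl

/-- [cite: MakinoBerz2003, Algorithm 2] -/
@[simp] theorem ratRows_cons (r : Poly) (rs : List Poly) :
    ratRows (r :: rs) = r.map ((↑) : ℚ → ℝ) :: ratRows rs := rfl

/-- [folklore] -/
private theorem continuous_evalR_row (as : List ℝ) : Continuous (evalR as) :=
  continuous_iff_continuousAt.2 fun x => (hasDerivAt_evalR as x).continuousAt

/-- [folklore] -/
private theorem continuous_evalR2_right : ∀ (p : List (List ℝ)) (ρ : ℝ), Continuous fun σ => evalR2 p ρ σ
  | [], _ => by simpa using continuous_const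
  | r :: rs, ρ => by
      simp only [evalR2_cons]
      exact (continuous_evalR_row r).add (continuous_const.mul (continuous_evalR2_right rs ρ))

/-- **Inner integral of rational rows**: `∫_{-k}^{k} Σᵢ ρⁱ pᵢ(σ) dσ = Σᵢ ρⁱ ∫ pᵢ`. [cite: MakinoBerz2003, Algorithm 2] -/
theorem integral_evalR2_ratRows (p : List Poly) (k : ℚ) (ρ : ℝ) :
    ∫ σ in (-(k : ℝ))..k, evalR2 (ratRows p) ρ σ = Poly.eval (p.map fun r => integRowQ r k) ρ := by
  induction p with
  | nil => simp
  | cons r rs ih =>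
      simp only [ratRows_cons, List.map_cons, evalR2_cons, Poly.eval_cons]
      have hc1 : IntervalIntegrable (fun σ => evalR (r.map ((↑) : ℚ → ℝ)) σ) volume (-(k : ℝ)) k :=
        (continuous_evalR_row _).intervalIntegrable _ _
      have hc2 : IntervalIntegrable (fun σ => ρ * evalR2 (ratRows rs) ρ σ) volume (-(k : ℝ)) k :=
        (continuous_const.mul (continuous_evalR2_right _ ρ)).intervalIntegrable _ _
      rw [intervalIntegral.integral_add hc1 hc2, intervalIntegral.integral_const_mul, ih,
        ← integral_eval_eq_integRowQ r k]
      congr 1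
      exact intervalIntegral.integral_congr fun σ _ => (Poly.eval_eq_evalR r σ).symm

/-- **Double integral of rational rows.** [cite: MakinoBerz2003, Algorithm 2] -/
theorem integral2_evalR2_ratRows (p : List Poly) (h k : ℚ) :
    ∫ ρ in (-(h : ℝ))..h, ∫ σ in (-(k : ℝ))..k, evalR2 (ratRows p) ρ σ = ((integ2Q p h k : ℚ) : ℝ) := by
  simp_rw [integral_evalR2_ratRows]
  exact integral_eval_eq_integRowQ _ h

/-- Thin bivariate model of rational rows (row-wise `ratPolyI`). [cite: MakinoBerz2003, Algorithm 2] -/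
def ratPoly2 (S : ℕ) (p : List Poly) : IPoly2 := p.map (ratPolyI S)

/-- [folklore] -/
private theorem pmem2_ratPoly2 (S : ℕ) : ∀ p : List Poly, PMem2 S (ratRows p) (ratPoly2 S p)
  | [] => by simpa [ratPoly2] using pmem2_nil S
  | r :: rs => by simpa [ratPoly2] using pmem2_cons (pmem_ratPoly S r) (pmem2_ratPoly2 S rs)

/-- Rational rows are enclosed exactly by their thin model, on any box. [cite: MakinoBerz2003, Algorithm 2] -/
theorem tmem2_ratPoly2 (S : ℕ) (h k : ℚ) (p : List Poly) :
    TMem2 S h k (fun ρ σ => evalR2 (ratRows p) ρ σ) (ratPoly2 S p) :=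
  fun _ _ _ _ => ⟨ratRows p, pmem2_ratPoly2 S p, rfl⟩

/-! ### The box estimate -/

/-- [folklore] -/
private theorem intervalIntegrable_of_abs_le {g : ℝ → ℝ} (hg : Measurable g) {k : ℚ} (k0 : 0 ≤ k) {M : ℝ}
    (hb : ∀ σ : ℝ, |σ| ≤ k → |g σ| ≤ M) : IntervalIntegrable g volume (-(k : ℝ)) k := by
  have hk : (0 : ℝ) ≤ k := by exact_mod_cast k0
  have hle : (-(k : ℝ)) ≤ k := by linarith
  rw [intervalIntegrable_iff_integrableOn_Icc_of_le hle]
  refine Measure.integrableOn_of_bounded (M := M)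
    (by rw [Real.volume_Icc]; exact ENNReal.ofReal_ne_top) hg.aestronglyMeasurable ?_
  refine (ae_restrict_iff' measurableSet_Icc).2 (Filter.Eventually.of_forall fun x hx => ?_)
  rw [Real.norm_eq_abs]
  exact hb x (abs_le.2 ⟨hx.1, hx.2⟩)

/-- [folklore] -/
private theorem abs_two_k {k : ℚ} (k0 : 0 ≤ k) : |(k : ℝ) - -(k : ℝ)| = 2 * k := by
  have hk : (0 : ℝ) ≤ k := by exact_mod_cast k0
  rw [sub_neg_eq_add, abs_of_nonneg (by positivity)]; ring

/-- **The box estimate** (op. cit. Algorithm 2, step 4: `∫_D f ⊂ ∫_D P + |D| · I`).  If `P` encloses a jointly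
measurable `f` on `|ρ| ≤ h, |σ| ≤ k`, then for every list of rational rows `p`,
`|∫_{-h}^{h} ∫_{-k}^{k} f − integ2Q p h k| ≤ (tabs2 S h k (P − p) / S) · 2k · 2h`; moreover the sections `σ ↦ f ρ σ`
(`|ρ| ≤ h`) and the inner integral `ρ ↦ ∫_{-k}^{k} f ρ σ dσ` are interval integrable. [cite: MakinoBerz2003, Algorithm 2] -/
theorem abs_integral2_sub_integ2Q_le {S : ℕ} (hS : 0 < S) {h k : ℚ} (h0 : 0 ≤ h) (k0 : 0 ≤ k)
    {f : ℝ → ℝ → ℝ} (hm : Measurable fun z : ℝ × ℝ => f z.1 z.2) {P : IPoly2} (hf : TMem2 S h k f P)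
    (p : List Poly) :
    |(∫ ρ in (-(h : ℝ))..h, ∫ σ in (-(k : ℝ))..k, f ρ σ) - ((integ2Q p h k : ℚ) : ℝ)| ≤
        (tabs2 S h k (tsub2 P (ratPoly2 S p)) : ℝ) / S * (2 * k) * (2 * h) ∧
      IntervalIntegrable (fun ρ => ∫ σ in (-(k : ℝ))..k, f ρ σ) volume (-(h : ℝ)) h ∧
      ∀ ρ : ℝ, |ρ| ≤ h → IntervalIntegrable (fun σ => f ρ σ) volume (-(k : ℝ)) k := by
  have hSr : (0 : ℝ) < S := by exact_mod_cast hS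
  have hhr : (0 : ℝ) ≤ h := by exact_mod_cast h0
  have hkr : (0 : ℝ) ≤ k := by exact_mod_cast k0
  have hkk : (-(k : ℝ)) ≤ k := by linarith
  have hhh : (-(h : ℝ)) ≤ h := by linarith
  -- pointwise bounds from the models
  have hA : ∀ ρ σ : ℝ, |ρ| ≤ h → |σ| ≤ k → |f ρ σ| ≤ (tabs2 S h k P : ℝ) / S := fun ρ σ hρ hσ => by
    rw [le_div_iff₀ hSr]; exact abs_le_tabs2 h0 k0 hf hρ hσ
  have hdiff := tmem2_sub hf (tmem2_ratPoly2 S h k p)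
  have hD : ∀ ρ σ : ℝ, |ρ| ≤ h → |σ| ≤ k →
      |f ρ σ - evalR2 (ratRows p) ρ σ| ≤ (tabs2 S h k (tsub2 P (ratPoly2 S p)) : ℝ) / S := fun ρ σ hρ hσ => by
    rw [le_div_iff₀ hSr]; exact abs_le_tabs2 h0 k0 hdiff hρ hσ
  -- the sections are measurable and integrable
  have hsec : ∀ ρ : ℝ, Measurable fun σ => f ρ σ := fun ρ => hm.comp measurable_prodMk_left
  have hIσ : ∀ ρ : ℝ, |ρ| ≤ h → IntervalIntegrable (fun σ => f ρ σ) volume (-(k : ℝ)) k := fun ρ hρ =>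
    intervalIntegrable_of_abs_le (hsec ρ) k0 fun σ hσ => hA ρ σ hρ hσ
  -- the inner integral is measurable (Fubini integrand) and bounded
  have hG : Measurable fun ρ => ∫ σ in (-(k : ℝ))..k, f ρ σ := by
    have hsm : StronglyMeasurable (Function.uncurry f) := hm.stronglyMeasurable
    have h1 : StronglyMeasurable fun ρ => ∫ σ, f ρ σ ∂(volume.restrict (Set.Ioc (-(k : ℝ)) k)) :=
      hsm.integral_prod_right
    have e : (fun ρ => ∫ σ in (-(k : ℝ))..k, f ρ σ) =
        fun ρ => ∫ σ, f ρ σ ∂(volume.restrict (Set.Ioc (-(k : ℝ)) k)) := by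
      funext ρ; rw [intervalIntegral.integral_of_le hkk]
    rw [e]; exact h1.measurable
  have hGb : ∀ ρ : ℝ, |ρ| ≤ h → |∫ σ in (-(k : ℝ))..k, f ρ σ| ≤ (tabs2 S h k P : ℝ) / S * (2 * k) :=
    fun ρ hρ => by
    have hpt : ∀ σ ∈ Ι (-(k : ℝ)) k, ‖f ρ σ‖ ≤ (tabs2 S h k P : ℝ) / S := fun σ hσ => by
      rw [uIoc_of_le hkk] at hσ
      rw [Real.norm_eq_abs]; exact hA ρ σ hρ (abs_le.2 ⟨hσ.1.le, hσ.2⟩)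
    have := norm_integral_le_of_norm_le_const hpt
    rw [Real.norm_eq_abs, abs_two_k k0] at this
    exact this
  have hIρ : IntervalIntegrable (fun ρ => ∫ σ in (-(k : ℝ))..k, f ρ σ) volume (-(h : ℝ)) h :=
    intervalIntegrable_of_abs_le hG h0 fun ρ hρ => hGb ρ hρ
  refine ⟨?_, hIρ, hIσ⟩
  -- the estimate: subtract the exactly integrated rational rows, bound pointwise twice
  have hq : IntervalIntegrable (fun ρ => Poly.eval (p.map fun r => integRowQ r k) ρ) volume (-(h : ℝ)) h :=
    (Poly.continuous_eval _).intervalIntegrable _ _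
  rw [integ2Q, ← integral_eval_eq_integRowQ, ← intervalIntegral.integral_sub hIρ hq]
  have hpt : ∀ ρ ∈ Ι (-(h : ℝ)) h,
      ‖(∫ σ in (-(k : ℝ))..k, f ρ σ) - Poly.eval (p.map fun r => integRowQ r k) ρ‖ ≤
        (tabs2 S h k (tsub2 P (ratPoly2 S p)) : ℝ) / S * (2 * k) := by
    intro ρ hρ'
    rw [uIoc_of_le hhh] at hρ'
    have hρ : |ρ| ≤ h := abs_le.2 ⟨hρ'.1.le, hρ'.2⟩
    rw [← integral_evalR2_ratRows p k ρ, ← intervalIntegral.integral_sub (hIσ ρ hρ)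
      ((continuous_evalR2_right _ ρ).intervalIntegrable _ _)]
    have hpt' : ∀ σ ∈ Ι (-(k : ℝ)) k, ‖f ρ σ - evalR2 (ratRows p) ρ σ‖ ≤
        (tabs2 S h k (tsub2 P (ratPoly2 S p)) : ℝ) / S := fun σ hσ => by
      rw [uIoc_of_le hkk] at hσ
      rw [Real.norm_eq_abs]; exact hD ρ σ hρ (abs_le.2 ⟨hσ.1.le, hσ.2⟩)
    have := norm_integral_le_of_norm_le_const hpt'
    rw [abs_two_k k0] at this
    exact this
  have := norm_integral_le_of_norm_le_const hpt
  rw [Real.norm_eq_abs, abs_two_k h0] at this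
  exact this

/-! ### The expression language in two variables -/

/-- Integrand expressions in the two real variables `x`, `y`: rational constants, the two identity variables,
negation, sum, product and the exponential (a finite code list of elementary operations and intrinsics, the input
of op. cit. Algorithm 2). [cite: MakinoBerz2003, Algorithm 2] -/
inductive BExpr : Type
  /-- the rational constant `q` -/
  | const (q : ℚ) : BExpr
  /-- the first variable `x` -/
  | varX : BExpr
  /-- the second variable `y` -/
  | varY : BExpr
  /-- `−A` -/
  | neg (A : BExpr) : BExpr
  /-- `A + B` -/
  | add (A B : BExpr) : BExpr
  /-- `A · B` -/
  | mul (A B : BExpr) : BExpr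
  /-- `e^{A}` -/
  | exp (A : BExpr) : BExpr

namespace BExpr

/-- The real function of two variables denoted by an expression. [cite: MakinoBerz2003, Algorithm 2] -/
noncomputable def toFun₂ : BExpr → ℝ → ℝ → ℝ
  | const q => fun _ _ => q
  | varX => fun x _ => x
  | varY => fun _ y => y
  | neg A => fun x y => -toFun₂ A x y
  | add A B => fun x y => toFun₂ A x y + toFun₂ B x y
  | mul A B => fun x y => toFun₂ A x y * toFun₂ B x y
  | exp A => fun x y => Real.exp (toFun₂ A x y)

/-- Joint (Borel) measurability of the denoted function. [cite: MakinoBerz2003, Algorithm 2] -/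
theorem measurable_toFun₂ : ∀ E : BExpr, Measurable fun z : ℝ × ℝ => E.toFun₂ z.1 z.2
  | const _ => measurable_const
  | varX => measurable_fst
  | varY => measurable_snd
  | neg A => (measurable_toFun₂ A).neg
  | add A B => (measurable_toFun₂ A).add (measurable_toFun₂ B)
  | mul A B => (measurable_toFun₂ A).mul (measurable_toFun₂ B)
  | exp A => Real.measurable_exp.comp (measurable_toFun₂ A)

/-- **The box Taylor model of `(u, v) ↦ E(cx + u, cy + v)` on `|u| ≤ h, |v| ≤ k`** with its acceptance flag
(scale `S`, total degree `D`, `K` series terms for `exp`, `Ke` terms / `ke` squarings for the constants `e^{c}`):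
steps 1–2 of op. cit. Algorithm 2 — the identity models `tvarX2`, `tvarY2`, then the code list in bivariate
Taylor-model arithmetic. [cite: MakinoBerz2003, Algorithm 2] -/
def model (S : ℕ) (h k : ℚ) (D K Ke ke : ℕ) (cx cy : ℚ) : BExpr → IPoly2 × Bool
  | const q => (tconst2 (ofRat S q), true)
  | varX => (tvarX2 S (ofRat S cx), true)
  | varY => (tvarY2 S (ofRat S cy), true)
  | neg A =>
      let r := model S h k D K Ke ke cx cy A
      (tneg2 r.1, r.2)
  | add A B =>
      let r := model S h k D K Ke ke cx cy A
      let r' := model S h k D K Ke ke cx cy B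
      (tadd2 r.1 r'.1, r.2 && r'.2)
  | mul A B =>
      let r := model S h k D K Ke ke cx cy A
      let r' := model S h k D K Ke ke cx cy B
      (tmul2 S h k D r.1 r'.1, r.2 && r'.2)
  | exp A =>
      let r := model S h k D K Ke ke cx cy A
      let t := texp2TM S h k D K Ke ke r.1
      (t.1, r.2 && t.2)

/-- **Soundness of `model`**: an accepted box model encloses `(u, v) ↦ E(cx + u, cy + v)` on `|u| ≤ h, |v| ≤ k`.
[cite: MakinoBerz2003, Algorithm 2] -/
theorem tmem2_model {S : ℕ} (hS : 0 < S) {h k : ℚ} (h0 : 0 ≤ h) (k0 : 0 ≤ k) {D K Ke ke : ℕ} (cx cy : ℚ) :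
    ∀ E : BExpr, (model S h k D K Ke ke cx cy E).2 = true →
      TMem2 S h k (fun u v => E.toFun₂ ((cx : ℝ) + u) ((cy : ℝ) + v)) (model S h k D K Ke ke cx cy E).1
  | const q, _ => by simpa [model, toFun₂] using tmem2_const (h := h) (k := k) (mem_ofRat S q)
  | varX, _ => by simpa [model, toFun₂] using tmem2_varX (S := S) (h := h) (k := k) (mem_ofRat S cx)
  | varY, _ => by simpa [model, toFun₂] using tmem2_varY (S := S) (h := h) (k := k) (mem_ofRat S cy)
  | neg A, hok => by
      simp only [model] at hok ⊢
      exact tmem2_neg (tmem2_model hS h0 k0 cx cy A hok)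
  | add A B, hok => by
      simp only [model, Bool.and_eq_true] at hok ⊢
      exact tmem2_add (tmem2_model hS h0 k0 cx cy A hok.1) (tmem2_model hS h0 k0 cx cy B hok.2)
  | mul A B, hok => by
      simp only [model, Bool.and_eq_true] at hok ⊢
      exact tmem2_mul hS h0 k0 D (tmem2_model hS h0 k0 cx cy A hok.1) (tmem2_model hS h0 k0 cx cy B hok.2)
  | exp A, hok => by
      simp only [model, Bool.and_eq_true] at hok ⊢
      exact tmem2_exp_of_texp2TM hS h0 k0 (tmem2_model hS h0 k0 cx cy A hok.1) hok.2

end BExpr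

/-! ### The certificate -/

/-- The rational midpoint rows of a bivariate model (the reference polynomial integrated exactly).
[cite: MakinoBerz2003, Algorithm 2] -/
def midRows (S : ℕ) (P : IPoly2) : List Poly :=
  P.map fun R => R.map fun I => ((I.lo + I.hi : ℤ) : ℚ) / (2 * (S : ℚ))

/-- The scaled box error `⌈B · 4hk⌉` (`B/S` bounds `|f − p|` on the box of area `4hk`). [cite: MakinoBerz2003, Algorithm 2] -/
def boxErr (h k : ℚ) (B : ℤ) : ℤ := ⌈(B : ℚ) * (4 * h * k)⌉

/-- **One box**: the enclosure of `∫_{-h}^{h} ∫_{-k}^{k} E(cx + u, cy + v) dv du` — the exact integral of the midpoint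
rows widened by the box error — and the acceptance flag of the box model. [cite: MakinoBerz2003, Algorithm 2] -/
def boxEncl (S : ℕ) (h k : ℚ) (D K Ke ke : ℕ) (E : BExpr) (cx cy : ℚ) : MI × Bool :=
  let r := BExpr.model S h k D K Ke ke cx cy E
  let p := midRows S r.1
  (MI.widen (ofRat S (integ2Q p h k)) (boxErr h k (tabs2 S h k (tsub2 r.1 (ratPoly2 S p)))), r.2)

/-- [folklore] -/
private theorem mem_zero2 (S : ℕ) : MI.mem S 0 ⟨0, 0⟩ := by simp [MI.mem]

/-- [folklore] -/
private theorem boxEncl_sound {S : ℕ} (hS : 0 < S) {h k : ℚ} (h0 : 0 < h) (k0 : 0 < k) {D K Ke ke : ℕ}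
    (E : BExpr) (cx cy : ℚ) (hok : (boxEncl S h k D K Ke ke E cx cy).2 = true) :
    MI.mem S (∫ u in (-(h : ℝ))..h, ∫ v in (-(k : ℝ))..k, E.toFun₂ ((cx : ℝ) + u) ((cy : ℝ) + v))
        (boxEncl S h k D K Ke ke E cx cy).1 ∧
      IntervalIntegrable (fun u => ∫ v in (-(k : ℝ))..k, E.toFun₂ ((cx : ℝ) + u) ((cy : ℝ) + v))
        volume (-(h : ℝ)) h ∧
      ∀ u : ℝ, |u| ≤ h →
        IntervalIntegrable (fun v => E.toFun₂ ((cx : ℝ) + u) ((cy : ℝ) + v)) volume (-(k : ℝ)) k := by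
  simp only [boxEncl] at hok ⊢
  have hT := BExpr.tmem2_model hS h0.le k0.le cx cy E hok (D := D) (K := K) (Ke := Ke) (ke := ke)
  have hm : Measurable fun z : ℝ × ℝ => E.toFun₂ ((cx : ℝ) + z.1) ((cy : ℝ) + z.2) :=
    (BExpr.measurable_toFun₂ E).comp
      ((measurable_const.add measurable_fst).prodMk (measurable_const.add measurable_snd))
  obtain ⟨hest, hI, hσ⟩ := abs_integral2_sub_integ2Q_le hS h0.le k0.le hm hT
    (midRows S (BExpr.model S h k D K Ke ke cx cy E).1)
  refine ⟨MI.mem_widen (mem_ofRat S _) ?_, hI, hσ⟩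
  have hSr : (0 : ℝ) < S := by exact_mod_cast hS
  set B : ℤ := tabs2 S h k (tsub2 (BExpr.model S h k D K Ke ke cx cy E).1
    (ratPoly2 S (midRows S (BExpr.model S h k D K Ke ke cx cy E).1))) with hB
  have h1 := mul_le_mul_of_nonneg_right hest hSr.le
  have h2 : (B : ℝ) / S * (2 * k) * (2 * h) * S = (((B : ℚ) * (4 * h * k) : ℚ) : ℝ) := by
    push_cast; field_simp; ring
  have h3 : (((B : ℚ) * (4 * h * k) : ℚ) : ℝ) ≤ (boxErr h k B : ℝ) := by
    unfold boxErr; exact_mod_cast Int.le_ceil _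
  rw [h2] at h1
  exact h1.trans h3

/-- **A column of boxes**: x-panel centre `cx`, `m` y-panels of half-width `k` starting at `y = a` (centres `a + k`,
`a + 3k`, …), summed; conjunctive flag. [cite: MakinoBerz2003, Algorithm 2] -/
def stripEncl (S : ℕ) (h k : ℚ) (D K Ke ke : ℕ) (E : BExpr) (cx : ℚ) : ℚ → ℕ → MI × Bool
  | _, 0 => (⟨0, 0⟩, true)
  | a, m + 1 =>
      let b := boxEncl S h k D K Ke ke E cx (a + k)
      let s := stripEncl S h k D K Ke ke E cx (a + 2 * k) m
      (MI.add b.1 s.1, b.2 && s.2)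

/-- [folklore] -/
private theorem stripEncl_sound {S : ℕ} (hS : 0 < S) {h k : ℚ} (h0 : 0 < h) (k0 : 0 < k) {D K Ke ke : ℕ}
    (E : BExpr) (cx : ℚ) : ∀ (m : ℕ) (a : ℚ), (stripEncl S h k D K Ke ke E cx a m).2 = true →
      MI.mem S (∫ u in (-(h : ℝ))..h, ∫ y in (a : ℝ)..((a : ℝ) + 2 * m * k), E.toFun₂ ((cx : ℝ) + u) y)
          (stripEncl S h k D K Ke ke E cx a m).1 ∧
        IntervalIntegrable (fun u => ∫ y in (a : ℝ)..((a : ℝ) + 2 * m * k), E.toFun₂ ((cx : ℝ) + u) y)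
          volume (-(h : ℝ)) h ∧
        ∀ u : ℝ, |u| ≤ h →
          IntervalIntegrable (fun y => E.toFun₂ ((cx : ℝ) + u) y) volume (a : ℝ) ((a : ℝ) + 2 * m * k)
  | 0, a, _ => by
      simp only [Nat.cast_zero, mul_zero, zero_mul, add_zero, intervalIntegral.integral_same,
        intervalIntegral.integral_zero, stripEncl]
      exact ⟨mem_zero2 S, intervalIntegrable_const, fun u _ => IntervalIntegrable.refl⟩
  | m + 1, a, hok => by
      have hhr : (0 : ℝ) ≤ h := by exact_mod_cast h0.le
      have hhh : (-(h : ℝ)) ≤ h := by linarith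
      simp only [stripEncl, Bool.and_eq_true] at hok ⊢
      obtain ⟨hb, hs⟩ := hok
      obtain ⟨hbm, hbI, hbσ⟩ := boxEncl_sound hS h0 k0 E cx (a + k) hb
      obtain ⟨ihm, ihI, ihσ⟩ := stripEncl_sound hS h0 k0 E cx m (a + 2 * k) hs
      -- endpoints
      have el : ((a + 2 * k : ℚ) : ℝ) = (a : ℝ) + 2 * k := by push_cast; ring
      have er : ((a + 2 * k : ℚ) : ℝ) + 2 * (m : ℝ) * k = (a : ℝ) + 2 * ((m + 1 : ℕ) : ℝ) * k := by
        push_cast; ring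
      rw [er, el] at ihm ihI ihσ
      have e1 : ((a + k : ℚ) : ℝ) + -(k : ℝ) = (a : ℝ) := by push_cast; ring
      have e2 : ((a + k : ℚ) : ℝ) + (k : ℝ) = (a : ℝ) + 2 * k := by push_cast; ring
      -- integrability on the first panel, pointwise in `u`
      have hfirst : ∀ u : ℝ, |u| ≤ h →
          IntervalIntegrable (fun y => E.toFun₂ ((cx : ℝ) + u) y) volume (a : ℝ) ((a : ℝ) + 2 * k) := by
        intro u hu
        have h1 := (hbσ u hu).comp_sub_right ((a + k : ℚ) : ℝ)
        have e0 : (fun y => E.toFun₂ ((cx : ℝ) + u) (((a + k : ℚ) : ℝ) + (y - ((a + k : ℚ) : ℝ)))) =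
            fun y => E.toFun₂ ((cx : ℝ) + u) y := by
          funext y; simp only [add_sub_cancel]
        have ea : -(k : ℝ) + ((a + k : ℚ) : ℝ) = (a : ℝ) := by push_cast; ring
        have eb : (k : ℝ) + ((a + k : ℚ) : ℝ) = (a : ℝ) + 2 * k := by push_cast; ring
        rw [e0, ea, eb] at h1
        exact h1
      -- the box integral, shifted to `y = (a + k) + v`
      have ebox : (fun u => ∫ v in (-(k : ℝ))..k, E.toFun₂ ((cx : ℝ) + u) (((a + k : ℚ) : ℝ) + v)) =
          fun u => ∫ y in (a : ℝ)..((a : ℝ) + 2 * k), E.toFun₂ ((cx : ℝ) + u) y := by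
        funext u
        rw [intervalIntegral.integral_comp_add_left (fun y => E.toFun₂ ((cx : ℝ) + u) y) ((a + k : ℚ) : ℝ),
          e1, e2]
      rw [ebox] at hbm hbI
      -- additivity of the inner integral on `|u| ≤ h`
      have heqOn : EqOn
          (fun u => (∫ y in (a : ℝ)..((a : ℝ) + 2 * k), E.toFun₂ ((cx : ℝ) + u) y) +
            ∫ y in ((a : ℝ) + 2 * k)..((a : ℝ) + 2 * ((m + 1 : ℕ) : ℝ) * k), E.toFun₂ ((cx : ℝ) + u) y)
          (fun u => ∫ y in (a : ℝ)..((a : ℝ) + 2 * ((m + 1 : ℕ) : ℝ) * k), E.toFun₂ ((cx : ℝ) + u) y)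
          (uIcc (-(h : ℝ)) h) := by
        intro u hu
        rw [uIcc_of_le hhh] at hu
        have hu' : |u| ≤ h := abs_le.2 ⟨hu.1, hu.2⟩
        exact intervalIntegral.integral_add_adjacent_intervals (hfirst u hu') (ihσ u hu')
      refine ⟨?_, ?_, fun u hu => (hfirst u hu).trans (ihσ u hu)⟩
      · rw [← intervalIntegral.integral_congr heqOn, intervalIntegral.integral_add hbI ihI]
        exact MI.mem_add hbm ihm
      · exact (hbI.add ihI).congr fun u hu => heqOn (uIoc_subset_uIcc hu)

/-- **The grid**: `n` columns of half-width `h` starting at `x = a` (centres `a + h`, `a + 3h`, …), each a column of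
`m` boxes starting at `y = ay`; summed, conjunctive flag. [cite: MakinoBerz2003, Algorithm 2] -/
def gridEncl (S : ℕ) (h k : ℚ) (D K Ke ke : ℕ) (E : BExpr) (ay : ℚ) (m : ℕ) : ℚ → ℕ → MI × Bool
  | _, 0 => (⟨0, 0⟩, true)
  | a, n + 1 =>
      let s := stripEncl S h k D K Ke ke E (a + h) ay m
      let g := gridEncl S h k D K Ke ke E ay m (a + 2 * h) n
      (MI.add s.1 g.1, s.2 && g.2)

/-- [folklore] -/
private theorem gridEncl_sound {S : ℕ} (hS : 0 < S) {h k : ℚ} (h0 : 0 < h) (k0 : 0 < k) {D K Ke ke : ℕ}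
    (E : BExpr) (ay : ℚ) (m : ℕ) : ∀ (n : ℕ) (a : ℚ), (gridEncl S h k D K Ke ke E ay m a n).2 = true →
      MI.mem S (∫ x in (a : ℝ)..((a : ℝ) + 2 * n * h), ∫ y in (ay : ℝ)..((ay : ℝ) + 2 * m * k), E.toFun₂ x y)
          (gridEncl S h k D K Ke ke E ay m a n).1 ∧
        IntervalIntegrable (fun x => ∫ y in (ay : ℝ)..((ay : ℝ) + 2 * m * k), E.toFun₂ x y)
          volume (a : ℝ) ((a : ℝ) + 2 * n * h)
  | 0, a, _ => by
      simp only [Nat.cast_zero, mul_zero, zero_mul, add_zero, intervalIntegral.integral_same, gridEncl]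
      exact ⟨mem_zero2 S, IntervalIntegrable.refl⟩
  | n + 1, a, hok => by
      simp only [gridEncl, Bool.and_eq_true] at hok ⊢
      obtain ⟨hs, hg⟩ := hok
      obtain ⟨hsm, hsI, -⟩ := stripEncl_sound hS h0 k0 E (a + h) m ay hs (D := D) (K := K) (Ke := Ke) (ke := ke)
      obtain ⟨ihm, ihI⟩ := gridEncl_sound hS h0 k0 E ay m n (a + 2 * h) hg
      have el : ((a + 2 * h : ℚ) : ℝ) = (a : ℝ) + 2 * h := by push_cast; ring
      have er : ((a + 2 * h : ℚ) : ℝ) + 2 * (n : ℝ) * h = (a : ℝ) + 2 * ((n + 1 : ℕ) : ℝ) * h := by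
        push_cast; ring
      rw [er, el] at ihm ihI
      have e1 : ((a + h : ℚ) : ℝ) + -(h : ℝ) = (a : ℝ) := by push_cast; ring
      have e2 : ((a + h : ℚ) : ℝ) + (h : ℝ) = (a : ℝ) + 2 * h := by push_cast; ring
      -- the column integral, shifted to `x = (a + h) + u`
      have hval : ∫ u in (-(h : ℝ))..h, ∫ y in (ay : ℝ)..((ay : ℝ) + 2 * m * k), E.toFun₂ (((a + h : ℚ) : ℝ) + u) y =
          ∫ x in (a : ℝ)..((a : ℝ) + 2 * h), ∫ y in (ay : ℝ)..((ay : ℝ) + 2 * m * k), E.toFun₂ x y := by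
        rw [intervalIntegral.integral_comp_add_left
          (fun x => ∫ y in (ay : ℝ)..((ay : ℝ) + 2 * m * k), E.toFun₂ x y) ((a + h : ℚ) : ℝ), e1, e2]
      have hI1 : IntervalIntegrable (fun x => ∫ y in (ay : ℝ)..((ay : ℝ) + 2 * m * k), E.toFun₂ x y)
          volume (a : ℝ) ((a : ℝ) + 2 * h) := by
        have h1 := hsI.comp_sub_right ((a + h : ℚ) : ℝ)
        have e0 : (fun x => ∫ y in (ay : ℝ)..((ay : ℝ) + 2 * m * k),
              E.toFun₂ (((a + h : ℚ) : ℝ) + (x - ((a + h : ℚ) : ℝ))) y) =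
            fun x => ∫ y in (ay : ℝ)..((ay : ℝ) + 2 * m * k), E.toFun₂ x y := by
          funext x; simp only [add_sub_cancel]
        have ea : -(h : ℝ) + ((a + h : ℚ) : ℝ) = (a : ℝ) := by push_cast; ring
        have eb : (h : ℝ) + ((a + h : ℚ) : ℝ) = (a : ℝ) + 2 * h := by push_cast; ring
        rw [e0, ea, eb] at h1
        exact h1
      rw [hval] at hsm
      refine ⟨?_, hI1.trans ihI⟩
      rw [← intervalIntegral.integral_add_adjacent_intervals hI1 ihI]
      exact MI.mem_add hsm ihm

/-- **The certificate** for `lo ≤ ∫_{ax}^{ax+2nh} ∫_{ay}^{ay+2mk} E(x, y) dy dx ≤ hi`: positivity of `S`, `h`, `k`,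
every box model accepted, and the kernel enclosure inside `[lo·S, hi·S]`. [cite: MakinoBerz2003, Algorithm 2] -/
def certCheck2 (S : ℕ) (h k : ℚ) (D K Ke ke : ℕ) (E : BExpr) (ax ay : ℚ) (n m : ℕ) (lo hi : ℚ) : Bool :=
  let g := gridEncl S h k D K Ke ke E ay m ax n
  decide (0 < S) && decide (0 < h) && decide (0 < k) && g.2 &&
    decide (lo * S ≤ (g.1.lo : ℚ)) && decide ((g.1.hi : ℚ) ≤ hi * S)

/-- **Soundness of the certificate** (no side hypotheses): Taylor-model quadrature over the `n × m` grid of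
boxes, the enclosure re-computed by the kernel from untrusted data (`decide`).
[cite: MakinoBerz2003, Algorithm 2] [cite: MahboubiMelquiondSibutpinote2016, Sect. 3.2 Lemma 3] -/
theorem integral_bounds_of_certCheck2 {S : ℕ} {h k : ℚ} {D K Ke ke : ℕ} {E : BExpr} {ax ay : ℚ} {n m : ℕ}
    {lo hi : ℚ} (hc : certCheck2 S h k D K Ke ke E ax ay n m lo hi = true) :
    (lo : ℝ) ≤ ∫ x in (ax : ℝ)..((ax : ℝ) + 2 * n * h), ∫ y in (ay : ℝ)..((ay : ℝ) + 2 * m * k), E.toFun₂ x y ∧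
      ∫ x in (ax : ℝ)..((ax : ℝ) + 2 * n * h), ∫ y in (ay : ℝ)..((ay : ℝ) + 2 * m * k), E.toFun₂ x y ≤ (hi : ℝ) := by
  unfold certCheck2 at hc
  simp only [Bool.and_eq_true, decide_eq_true_eq] at hc
  obtain ⟨⟨⟨⟨⟨hS, h0⟩, k0⟩, hok⟩, hlo⟩, hhi⟩ := hc
  obtain ⟨⟨h1, h2⟩, -⟩ := gridEncl_sound hS h0 k0 E ay m n ax hok (D := D) (K := K) (Ke := Ke) (ke := ke)
  have hSr : (0 : ℝ) < S := by exact_mod_cast hS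
  have hloR : (lo : ℝ) * S ≤ ((gridEncl S h k D K Ke ke E ay m ax n).1.lo : ℝ) := by exact_mod_cast hlo
  have hhiR : ((gridEncl S h k D K Ke ke E ay m ax n).1.hi : ℝ) ≤ (hi : ℝ) * S := by exact_mod_cast hhi
  exact ⟨le_of_mul_le_mul_right (hloR.trans h1) hSr, le_of_mul_le_mul_right (h2.trans hhiR) hSr⟩

end PolyMP

end Literature.Analysis.ValidatedNumerics
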